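import Mathlib
import HarnessLib
import HarnessLib.Audit
import Summits.ABC.Statement
import HarnessLib.Audit.Status.Attr

/-!
Route: RootDecompJ

# Route CampanaTrichotomy — abc splits by the orbifold Euler characteristic of the powerfulness
profile — Orbifold Mordell for the three-point line, abc on the Euclidean thin cell, abc on the
spherical bulk (declared residual)

It suffices to show X = CampanaHyperbolicBound ∧ EuclideanTypeABC ∧ SphericalABC (root OR-node of
cell decomp-abc, lens 1 «exponent / quality
ladder», generation 6; no card realised; R2 re-glue 2026-09-01, writer decomp-abc-writer-1 g37 on
critic crit-1 g11's kernel finding: the rev-3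
Euclidean binder EuclideanABC (stmt-ABC-29354) was typed «admits a weight-1 signature», a cell that
CONTAINS the hyperbolic cell because
admissibility is downward closed in the multiplicities (critic `hypType_subset_eucShape`), so that
EuclideanABC ⟹ CampanaHyperbolicBound and
in kernel EuclideanABC ⟺ CampanaHyperbolicBound ∧ EuclideanTypeABC (critic
`euclideanABC_iff_hyp_and_gen`, HOME/critic/DoorJ_HypInEuc_g11.lean
rev 2 sha16 ac452fa235bdea86); EuclideanABC is banked ASIDE verbatim and the binder is now the
genuinely Euclidean cell). Type an abc triple (a,b,c) by its POWERFULNESS PROFILE: (p,q,r) is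
admissible when a is p-full,
b is q-full, c is r-full (every prime to exponent ≥ p; multiplicity ∞ only at the member 1, encoded
p = 0 with weight 0⁻¹ = 0), i.e. when
(a : c) is an integral point of the Campana orbifold (ℙ¹; (1−1/p)[0] + (1−1/q)[1] + (1−1/r)[∞]) over
ℤ. CampanaHyperbolicBound (P_H): the
triples admitting a weight 1/p+1/q+1/r < 1 (χ < 0) have bounded c — Campana's Orbifold Mordell
conjecture for the three-point line, all
hyperbolic signatures at once. EuclideanTypeABC (P_E): abc (∀ε) on the triples admitting weight
exactly 1 AND NONE BELOW (both conjuncts typed) — signatures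
(2,3,6), (2,4,4), (3,3,3), (∞,2,2): CM twists and consecutive powerful numbers, a thin set (the χ =
0 cell: 14 of 20185 known hits,
26 members with c ≤ 10^10, 74 ≤ 10^18). SphericalABC (P_S): abc on all remaining triples (every
admissible weight > 1) — the bulk, DECLARED RESIDUAL. EXACT: ABC ⟺ P_H ∧ P_E ∧ P_S (kernel
`nodeR2_iff`, writer certificate J5/RootDecompJ_R2_certificate.lean = critic `nodeR2_iff`; the
three cells are a genuine PARTITION — cover `hyp_or_genEuc_or_sph`, pairwise disjoint; `closes` by
the trichotomy of the weight; the rev-3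
node `node_iff` with EuclideanABC was exact too but P_H was implied by its P_E: critic
`doorJ_exact_two`); the two thin pieces are certified transport-immune by a kernel theorem
(Mason–Stothers ⟹ no coprime p,q,r-full polynomial identity
with 1/p+1/q+1/r ≤ 1).
Lean: `(∃ B : ℕ, ∀ a b c : ℕ, Literature.NumberTheory.DiophantineGeometry.IsABCTriple a b c → (∃ p q
r : ℕ, ((p = 0 → a = 1) ∧ ∀ ℓ ∈ a.primeFactors, p ≤ a.factorization ℓ) ∧ ((q = 0 → b = 1) ∧ ∀ ℓ ∈
b.primeFactors, q ≤ b.factorization ℓ) ∧ ((r = 0 → c = 1) ∧ ∀ ℓ ∈ c.primeFactors, r ≤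
c.factorization ℓ) ∧ (p : ℚ)⁻¹ + (q : ℚ)⁻¹ + (r : ℚ)⁻¹ < 1) → c ≤ B) ∧ (∀ ε : ℝ, 0 < ε → ∃ C : ℝ, 0
< C ∧ ∀ a b c : ℕ, Literature.NumberTheory.DiophantineGeometry.IsABCTriple a b c → ((∃ p q r : ℕ,
((p = 0 → a = 1) ∧ ∀ ℓ ∈ a.primeFactors, p ≤ a.factorization ℓ) ∧ ((q = 0 → b = 1) ∧ ∀ ℓ ∈
b.primeFactors, q ≤ b.factorization ℓ) ∧ ((r = 0 → c = 1) ∧ ∀ ℓ ∈ c.primeFactors, r ≤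
c.factorization ℓ) ∧ (p : ℚ)⁻¹ + (q : ℚ)⁻¹ + (r : ℚ)⁻¹ = 1) ∧ ¬ (∃ p q r : ℕ, ((p = 0 → a = 1) ∧ ∀ ℓ
∈ a.primeFactors, p ≤ a.factorization ℓ) ∧ ((q = 0 → b = 1) ∧ ∀ ℓ ∈ b.primeFactors, q ≤
b.factorization ℓ) ∧ ((r = 0 → c = 1) ∧ ∀ ℓ ∈ c.primeFactors, r ≤ c.factorization ℓ) ∧ (p : ℚ)⁻¹ +
(q : ℚ)⁻¹ + (r : ℚ)⁻¹ < 1)) → (c : ℝ) < C * ((Literature.NumberTheory.DiophantineGeometry.rad a b c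
: ℕ) : ℝ) ^ (1 + ε)) ∧ (∀ ε : ℝ, 0 < ε → ∃ C : ℝ, 0 < C ∧ ∀ a b c : ℕ,
Literature.NumberTheory.DiophantineGeometry.IsABCTriple a b c → (∀ p q r : ℕ, ((p = 0 → a = 1) ∧ ∀ ℓ
∈ a.primeFactors, p ≤ a.factorization ℓ) → ((q = 0 → b = 1) ∧ ∀ ℓ ∈ b.primeFactors, q ≤
b.factorization ℓ) → ((r = 0 → c = 1) ∧ ∀ ℓ ∈ c.primeFactors, r ≤ c.factorization ℓ) → 1 < (p : ℚ)⁻¹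
+ (q : ℚ)⁻¹ + (r : ℚ)⁻¹) → (c : ℝ) < C * ((Literature.NumberTheory.DiophantineGeometry.rad a b c :
ℕ) : ℝ) ^ (1 + ε))`

## Assembly
Twenty lines of logic (R2 glue J5/apply/glue5.lean `closes` = writer certificate `closes5`; rev-3
pkg/glue6.lean differed only in the
Euclidean branch): given ε, take B from P_H and C_E, C_S from
P_E, P_S at ε; set C = max(B+1, C_E, C_S). A triple either admits a weight < 1 (then c ≤ B <
(B+1)·rad^(1+ε) since rad ≥ 1), or admits
weight exactly 1 and none below (P_E, fed the pair ⟨weight-1 witness, no weight < 1⟩), or every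
admissible weight is > 1 (lt_trichotomy per (p,q,r); P_S). Conversely abc implies all
three pieces (kernel `campanaHyperbolicBound_of_abc` via PolyABC(43/42), `euclideanTypeABC_of_abc`,
`sphericalABC_of_abc`), so the node is exact.

Rationale: WHY THIS LINE. Campana's theory of orbifold pairs attaches to the equation a + b = c with imposed
minimal multiplicities (p,q,r) the orbifold base
(ℙ¹; Δ) whose Euler characteristic χ = 1/p+1/q+1/r − 1 governs integral points exactly as genus
governs curves: finitely many when χ < 0
(Orbifold Mordell, open for genus ≤ 1 with finite multiplicities, arXiv:2410.06643 p.5; implied by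
abc via Elkies–Abramovich–Campana–Smeets
and proved over function fields, arXiv:2603.28745 p.5), logarithmic growth when χ = 0, order B^χ
when χ > 0 (Browning–Van Valckenborgh
arXiv:1106.4472 p.3). The node imports this trichotomy as an EXACT DECOMPOSITION of abc itself — the
implication in print runs only
abc ⟹ Orbifold Mordell — and certifies in the kernel (i) that P_H is strictly weaker than abc
(PolyABC(43/42) ⟹ P_H: rad(abc)^42 < c^41 on
hyperbolic triples, the (2,3,7) gap), (ii) that no identity-based transport (squaring, k-th powers,
Pythagorean parametrisation, the T_k /
β / γ maps used against earlier doors of this cell) can move a co-thin family into the hyperbolic or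
Euclidean cells (`no_powerful_syzygy`,
from Mathlib's Mason–Stothers theorem), and (iii) decided sub-boxes of P_H: the Catalan corner (1,
y^q, z^r) ⟹ c = 9 unconditionally from
the tree's proved Mihăilescu theorem, the Fermat boxes (4,4,4), (3,3,3), (4,4,2) empty from Mathlib,
every fixed-signature perfect-power box
bounded modulo the tree fact darmon_granville (DarmonGranville1995). Imported areas: arithmetic
geometry of Campana pairs (arXiv:1908.10263,
arXiv:2410.06643, arXiv:2603.28745), the modular/Chabauty resolution of generalized Fermat equations
per signature (arXiv:math/0508174),
Mason–Stothers. No prior route of the summit types Campana profiles: E (this lens, gen 5) uses the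
LEVEL of one signature (2,3,7) and its
bottom rung KleinLevelOne is implied by P_H (kernel `kleinLevelOne_of_hypBound`); B/G cut by
exponent-divisibility of the radical, C/H by Serre
level, D by top-exponent forgiveness, A by smooth radical mass, F by cyclotomic torsion; the
negatives index has no profile statement.

RANKED CRUXES. #2 CampanaHyperbolicBound (crux) — ORBIFOLD MORDELL FOR THE THREE-POINT LINE OVER ℤ —
there is one bound B such that every abc triple (a,b,c) admitting multiplicities (p,q,r) (a p-full,
b q-full, c r-full; ∞ ↔ member 1) with 1/p+1/q+1/r < 1 has c ≤ B. WEAKER than abc, kernel-certified: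
PolyABC(43/42) ⟹ P_H (abc at the single instance ε = 1/42; integer heart rad(abc)^42 < c^41);
contains Fermat–Catalan boundedness and route E's KleinLevelOne (kernel); decided sub-boxes: Catalan
corner c = 9 (tree-proved Mihăilescu), FLT(4) box empty, fixed-signature perfect-power boxes bounded
mod darmon_granville; exhaustive census: exactly 10 hyperbolic coprime triples with c ≤ 10^10 (four
not perfect-power triples, e.g. 5³ + 3⁷ = 2³·17²) plus the five known Fermat–Catalan solutions above
10^10; the (2,3,7) positional corner exhausted to 10^18 with 3 members (census-1 kit j338739).
[difficulty: open-problem] (why it might fail: an infinite family of coprime p-,q-,r-full solutions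
of ONE hyperbolic signature with unbounded powerful cofactors (e.g. x²u³ + y³v⁴w⁵ = 7-full) — none
known below 10^18; it would refute abc, which implies P_H (kernel).) [arXiv:2410.06643,
arXiv:2603.28745, arXiv:1106.4472, arXiv:1908.10263, DarmonGranville1995, arXiv:math/0508174,
Mihailescu2004]
#3 EuclideanTypeABC (crux) — abc (for every ε, some C) on the triples of genuinely EUCLIDEAN Campana
type: some admissible (p,q,r) has 1/p+1/q+1/r = 1 AND no admissible (p,q,r) has 1/p+1/q+1/r < 1 —
signatures (2,3,6), (2,4,4), (3,3,3) with all members ≥ 2 (integral points of cube-full-class twists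
of the CM curves j = 0, 1728: u x³ + v y³ = w z³-type) and (∞,2,2) (a member 1 and two squareful
members: consecutive powerful numbers, Pell families 1 + (x²−1) = x²). WEAKER: the restriction of
abc to a thin, transport-immune cell (χ = 0: count ≪ log B conjecturally, N ≫ log B known (Nitaj);
exactly 26 members with c ≤ 10^10 and 74 with c ≤ 10^18, 14 among the 20185 known hits); boxes
(3,3,3) and (4,4,2) with unit coefficients empty (Mathlib); every member is an abc hit. R2
(2026-09-01, writer g37 on critic g11's kernel certificate DoorJ_HypInEuc_g11.lean rev 2
ac452fa235bdea86): this item REPLACES as binder the rev-3 item EuclideanABC (stmt-ABC-29354, now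
ASIDE, kept verbatim), whose typed cell «admits a weight-1 signature» contains the whole hyperbolic
cell (HypType ⊆ EucShape; 23 hits, 36 ≤ 10^10, 93 ≤ 10^18) so that EuclideanABC ⟹
CampanaHyperbolicBound; in kernel EuclideanABC ⟺ #2 ∧ #3 and ABC ⟺ #2 ∧ #3 ∧ #4 (`nodeR2_iff`).
[difficulty: open-problem] (why it might fail: cannot fail without refuting abc (restriction, NEC in
kernel); as a TARGET: abc along ONE CM twist x³+y³=A of positive rank is open — EDS
primitive-divisor / Siegel bounds are ineffective or save only logarithms, and uniformity in the
twist A and over Pell powerful parts needs an idea.) [arXiv:1106.4472, arXiv:2404.03970,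
arXiv:2601.07817, Nitaj1995, arXiv:math/0508174]
#4 SphericalABC (crux) — abc (for every ε, some C) on the SPHERICAL triples: every admissible
(p,q,r) has 1/p+1/q+1/r > 1 — in particular every triple with a prime to the first power in two of
its members. DECLARED RESIDUAL (≈ abc: 20162 of the 20185 known hits); it receives every
identity-based transport by the kernel theorem no_powerful_syzygy (Mason–Stothers: coprime
polynomial identities with p-,q-,r-full members are spherical), and it is NOT kernel-costume: the
probes P_S → ABC fail under three batteries, the squared Pythagorean transport escaping to the other
cells exactly on the doubly-squareful thin set. [difficulty: open-problem] (why it might fail: it is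
abc on a co-thin set (abc-in-waiting by population, declared); inside
Literature.Barriers.ABC.BakerMethodBounds for any ε-uniform statement — disclosed, same species as
the residuals of B/G/E.) [arXiv:1106.4472, StewartYu2001, Mathlib:Polynomial.abc]

TWO-LAYER PLAN. Foreseen once the root clears (nothing filed now): CampanaHyperbolicBound ⟸
(FixedSignatureTwistBound: for each hyperbolic (p,q,r) and each
triple of powerful cofactor classes, bounded c — the Darmon–Granville / modular / Chabauty unit,
decided in print for several untwisted boxes)
∧ (SignatureUniformity: a bound uniform over the cofactor classes of one signature — the genuine
Orbifold-Mordell content); EuclideanTypeABC ⟸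
(abc along each CM twist family (2,3,6)/(2,4,4)/(3,3,3)) ∧ (abc for consecutive powerful numbers,
the (∞,2,2) cell). SphericalABC is the
residual and is not decomposed by this route (its sub-structure is the business of the other doors
A–H, all of which cut inside it).

KILL CRITERIA. No piece is refutable without refuting abc (all three are kernel consequences of
ABC). The route is retired `superseded` if another door
acquires a road on a class containing the spherical bulk; it is re-rooted if a refuter exhibits an
identity-based transport landing a co-thin
family in the hyperbolic or Euclidean cell (impossible over ℚ(t) by `no_powerful_syzygy`; an
integer-specialisation phenomenon would have to
be genuinely arithmetic). A disproof of Orbifold Mordell for some (ℙ¹; p,q,r) over ℤ kills P_H and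
abc with it.

NOT DECOMPOSED YET. The per-signature twist boxes of P_H and their uniformity (layer 2, above), the
CM-twist families of P_E, the residual P_S (deliberately:
it is the declared abc-in-waiting bulk), constants (B ≥ 15613³ from 33⁸ + 1549034² = 15613³; the
PolyABC(43/42) constant transfer
B = ⌈C^1764⌉ is recorded in kernel only as a certificate, not as a target).

CHEAPEST FALSIFIER. A twisted hyperbolic family: coprime u x^p + v y^q = w z^r with (p,q,r)
hyperbolic, u,v,w powerful of the right classes and unbounded
height. Run: exhaustive census of ALL coprime triples with every member powerful-or-1, c ≤ 10^7
(3281 triples: HYP 9, EUC 10, SPH 3262)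
and of all hyperbolic / Euclidean-shaped coprime triples to 10^10 (HYP 10, EUC 26;
campana_census.json sha256 d453cb04…); census-1's
kit j338739 exhausts the (2,3,7) positional corner to 10^18 (3 members, all pure Klein points).
Structural kill attempted and failed in
kernel: the squared Pythagorean transport does not map the bulk into Hyp ∪ Euc (BC2 probes P_S → ABC
fail; immunity theorem).

NUMBERS. Hyperbolic gap: 1/p+1/q+1/r < 1 ⟹ ≤ 41/42 (finite multiplicities; extremal (2,3,7)), ≤ 5/6
with a member 1 (extremal (∞,2,3)); hence
rad(abc)^42 < c^41 on hyperbolic triples and PolyABC(43/42) ⟹ P_H (kernel). Known hyperbolic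
members: 10 below 10^10, 5 more in print
(largest 33⁸ + 1549034² = 15613³ ≈ 3.8·10^12); Euclidean members: 26 below 10^10 (12 of type
(∞,2,2)); spherical: 20162/20185 known hits,
3433 with all members having a first-power prime. BVV squareful counts N₁(10^k), k=4..7: 150, 554,
1910, 6562 vs conjectural 2.677·B^(1/2)
(arXiv:1106.4472 Conj. 1). Poonen–Schaefer–Stoll: primitive x²+y³=z⁷ has z ≤ 113
(arXiv:math/0508174).

DEFINITION REQUESTS. None: admissibility is inlined as `((p = 0 → a = 1) ∧ ∀ ℓ ∈ a.primeFactors, p ≤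
a.factorization ℓ)` and the weight as `(p : ℚ)⁻¹ + (q : ℚ)⁻¹ +
(r : ℚ)⁻¹` (Lean's 0⁻¹ = 0 encodes multiplicity ∞); `IsABCTriple`, `rad` exist
(Literature.NumberTheory.DiophantineGeometry). Named-fact wish
(not blocking): `orbifoldMordell_P1` (Campana 2005 Conj.; arXiv:2603.28745 Conj. 1.9) as a
Literature conjecture record for citation only.

Workshop record (writer decomp-abc-writer-1-g3, cell decomp-abc, LADDER-abc rung 0, D-0178): this is
root node CampanaTrichotomy of lens lens-1 «exponent / quality ladder» generation 6 (NODE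
2026-08-30T06:00:46Z HOME/STATUS.md l.364, NOTE l.365 (NODE-g6.md amended), writer-package NOTE
l.371; lens draft file CampanaTrichotomy.lean sha256
863ea88e260d6934f5714cfe686f32540b5dfcd6ec3581331bc4a41d0f5302c2, 900 lines, 0 sorry, axioms std ×10
(bc/axioms.txt); NODE-g6.md sha256 c9eca319c627c6de032167fee78511d13150931dd8978692a80c69d51c6407fd;
items pkg/node6.json sha256 c8ef1c974c0614b74240d0987c64044dc78e4c43a5849285d7027115606d0177
(statements byte-identical to the lens's Route.md / route.json); glue pkg/glue6.lean sha256
c2996adafffa411822703c64caf86df7bd1e3b69ba2c52518dd4577bbfe5090c (adopted verbatim as the deciding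
theorem); BC5 witness file CampanaTrichotomyWitness.lean sha256
7a61bbed625cc9517e35c3b3cd1908d0b7f32e74dfb4dc4b1c9b964e3ebfba15
(campanaTrichotomy_catalanCorner_bound: the crux on the Catalan corner (1, y^q, z^r) with B = 9,
UNCONDITIONAL via the tree-proved mihailescu_holds; lean check rc 0 · 0 sorry · std axioms; to land
under Summits/ABC/ABC/Theorems/ by a prover, then `--witness
Summit.ABC.ABC.Theorems.campanaTrichotomy_catalanCorner_bound --s-case
Summit.ABC.ABC.Theorems.CampanaTrichotomyHyperbolicABC`); instrument campana_census.json sha256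
d453cb04dcd65ec9ff67f73ba15703a584c70a45790c2777f42e4f64b0a4a989 (20185 known hits typed HYP 9 / EUC
14 / SPH 20162; exhaustive HYP/EUC to 10^10: 10 / 26; census-1 j338739: the (2,3,7) corner exhausted
to 10^18 with exactly the three pure Klein points); cell census of record COSTUME-CENSUS-v6.md
sha256 2cdd62f8ef2f57f07a6de16574c49cade514a108aecfe93cf8656bbe64b6d7f5 / .json
353996fb422aa5e40daa78a45d1f890d2c068689d6a8ab0ca6a62cde17cfd4d8, instrument ANSWERS-g6.md sha256
b9a5e092816e73c0b84c4a2cbb20fb2825cefba27d1e7729a487dbf938fe29ed), adopted as OR-sibling RootDecompJ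
of the root decomposition (tenth route file of the cell; siblings RootDecompA–I; kinship edge in
kernel: CampanaHyperbolicBound ⟹ RootDecompE.KleinLevelOne stmt-ABC-28220 (E's populated bottom rung
is the (2,3,7) corner of the hyperbolic cell) and ⟹ FermatCatalanBounded; E's closes untouched);
lens NOTE l.380 (06:24:09Z): lens file STRENGTHENED to CampanaTrichotomy.lean sha256
29e20ef510c17c0cd2f84f6dfd670867c4c46fbdedc51da6f2bf30de55ab6a8c, 969 lines (added
no_unit_powerful_syzygy / one_lt_wt_of_unit_syzygy / unit_signatures_excluded: the member-1 unit
signatures (∞,2,3) ⊂ Hyp and (∞,2,2) ⊂ Euc transport-immune BY THEOREM), NODE-g6.md → sha256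
b893c5ae928eebd33ace6750cd342e721226087c14cf4369aa00bad9c078748c, node6.json → d4382a8fd90e7f73…,
items / glue / route.json UNCHANGED (writer item-by-item diff of the lens route.json vs this file: 0
differences), optional second layer pkg/children6.lean + children6.json (CampanaHyperbolicBound ⟺
UnitNeighbourBound ∧ ProperHyperbolicBound, glue hypBound_of_unit_of_proper, exact hypBound_iff; rc0
std axioms) HELD — not filed (critic w3 agreed: free population split, both children
uniformity-open, no rung gained); writer re-check J6/CampanaTrichotomy_check2.lean sha16
7c7646e1aec7dad4 (strengthened lens file l.1–967 + Iff.rfl ×4 on the item texts incl. Assembly +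
kernel facts node_iff / closes / campanaHyperbolicBound_of_abc / euclideanABC_of_abc /
sphericalABC_of_abc / kleinLevelOne_of_hypBound / fermatCatalanBounded_of_hypBound by name) lean
check rc 0 · 0 err · 0 sorry · axioms(node_iff, closes, kleinLevelOne_of_hypBound,
no_powerful_syzygy, one_lt_wt_of_unit_syzygy) std; critic CLEARED decomp-abc-crit-1-g2
2026-08-30T06:28:37Z (HOME/STATUS.md l.384): (reviewing rev 1 @863ea88e, 900 l; the l.380
strengthening only ADDS theorems) own lean_check rc0 · 0 err · 0 warn · 0 sorry, axioms(node_iff) =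
axioms(catalanCorner) std ⇒ «Catalan corner decided UNCONDITIONALLY» CONFIRMED (mihailescu_holds is
a kernel theorem, AbcWave0MihailescuProofs.lean:299); item texts route.json 4/4 = node6.json 4/4 =
node defs verbatim mod FQN; closes ROOT-typed; GUARDS: exact AND (node_iff, 3 pieces;
hyp_or_euc_or_sph + sphType_iff_not) ✓, NEC ×3 kernel ✓, no EQUIV layer ✓, T4 population split
judged on cell content, T1/ε-TIE n/a (no dial), R-KNOWN P_H / P_E open ✓ (census WK10-C5 / WK12 are
SUB-statements), R-TRANSPORT on the residual RE-DERIVED by the critic (Sph = some member ≠ 1 with a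
prime to the first power ∪ all-powerful with spherical signatures; identity maps add fresh linear
factors whose fullness is unknowable in kernel — Ribenboim–Walsh — ⇒ no finite syzygy battery
certifies P_S ⟹ abc on Hyp ∪ Euc ⇒ P_S NOT kernel-costume, TRANSPORT-STABLE in the 28219/23645/27124
sense ✓), INTO-immunity of the thin cells a KERNEL THEOREM (no_powerful_syzygy / one_lt_wt_of_syzygy
from Mathlib Polynomial.abc; the census-trib-2 «syzygy transport closure» demand met as a theorem —
commended), R-EXP suspicion on P_E DISCHARGED by that theorem, R-EMPTY (a) n/a (b) w1 (c) cells
inhabited (Hyp 10 below 10^10 + 5 printed FC; Euc 26 below 10^10, infinite via Pell (1, 8y², x²);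
census-1 kit job l.377 optional) ✓; score 0 (THIN ∧ THIN ∧ RESIDUAL taxonomy door; precedent F
26430/26431, E rev 3); W-ITEMS (none blocking birth): w1 — lens-1 g7 owes ONE open rung WITH A ROAD
as support r9 (candidates: r1 CampanaSupportRung S B — all-powerful/hyperbolic abc triples with
rad(abc) ∣ ∏S have c ≤ B: S ⊆ {2,3} inside the Catalan corner (B = 9, kernel), S = primes ≤ 13
DECIDED IN PRINT (de Weger 1987) ⇒ certificate rung in the B/G KummerSupportRung style; r2 E's
SumRung ladder 26461 ff. / 28221 by KINSHIP — cite, do not duplicate; r3 under P_E the Pell/Lucas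
powerful-part rung for x² − 8y² = 1, Baker inside), w2 — witness caution:
campanaTrichotomy_catalanCorner_bound decides P_H on a corner where S is ALSO decided (single triple
(1,8,9) after Mihăilescu) — inside S's decided regime; P_H's weakness evidence is the SANDWICH
PolyABC(43/42) ⟹ P_H (converse unknown), not the corner — say so in the witness docstring (cell
practice tolerates ∅/finite-corner witnesses: B/G SupportRung), w3 — children6 HOLD agreed; TEXT t1
docstring CampanaTrichotomy.lean l.820–822 «the squared Pythagorean transport sends every abc triple
into the spherical cell» FALSE as stated (image non-spherical iff ≥ 2 bases squareful; NODE §1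
correct) — fix docstring, t2 typed EucShape does not exclude Hyp (a (2,4,5)-full triple admits
(2,4,4)): P_E as typed = abc on {admits a weight-1 signature} ⊋ the χ = 0 cell, overlap ⊆ Hyp
bounded by P_H, exactness unaffected — cosmetic, t3 «two light members» → one; distinctness vs doors
A–H ✓ (no door types fullness profiles; nearest E = the (2,3,7) corner, kernel edge; B/G Kummer
cells and lens-4 Mordell boxes are sub-boxes) ⇒ its OWN door; novelty sentence plausible (grade not
the critic's); tally g2 CLEARED 2 / OBJECTION 0; per-piece tags: CampanaHyperbolicBound WEAKER
(kernel PolyABC(43/42) ⟹ it; abc ⟹ it) · NAMED (Campana's Orbifold Mordell for the three-point line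
over ℤ, all hyperbolic signatures) · thin (10 members below 10^10) · ATTACKABLE per twist box,
IDEA-NEEDED for uniformity over twists; EuclideanABC WEAKER (restriction of S to the thin
transport-immune χ = 0 cell; 26 members below 10^10) · IDEA-NEEDED; SphericalABC DECLARED RESIDUAL ≈
S by population (20162/20185 hits; receives every identity-based transport — kernel
no_powerful_syzygy from Mathlib Mason–Stothers: every coprime p,q,r-full polynomial identity has
1/p+1/q+1/r > 1), NOT kernel-costume (P_S → ABC probes FAIL ×3), BakerMethodBounds INSIDE
(disclosed), tribunal_fit.residual; pre-birth tribunal pre-check (writer, renamed draft): --quick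
and --full PROVISIONAL (t1_kernel clean ×3, residual SphericalABC declared, t3k absent ⇒ plan-only
until the witness lands, t4 unmatched: no registered method_family for Campana / Darmon–Granville).
WHY THIS IS NOVEL: it is the first route in the tree to type abc triples by the CAMPANA / FULLNESS
PROFILE — the minimum exponent of each member separately, summed as the orbifold Euler
characteristic 1/p + 1/q + 1/r − 1 of the orbifold (ℙ¹; (1−1/p)[0] + (1−1/q)[1] + (1−1/r)[∞]) of
which (a : c) is an integral point — rather than by max-exponent (D/H), radical divisibility (B/G),
level (C/E/H) or radical mass (A/I); the hyperbolic piece is a NAMED open conjecture strictly below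
abc (Orbifold Mordell for the three-point line, implied by abc at the single instance ε = 1/42), the
Euclidean piece is abc on the χ = 0 thin cell (CM twists + consecutive powerful numbers), and the
transport immunity of both thin pieces is a THEOREM (no_powerful_syzygy), so the declared residual
is exactly the spherical bulk. IUT is not cited. R2 record (writer decomp-abc-writer-1 g37,
2026-09-01, critic crit-1 g11 SUMMON 20260901T163949Z class (ii) + ADDENDUM): EuclideanABC 29354 →
ASIDE (step 1), new crux EuclideanTypeABC rank 3 + closes re-glued on (CampanaHyperbolicBound,
EuclideanTypeABC, SphericalABC) (step 2); kernel certificates critic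
HOME/critic/DoorJ_HypInEuc_g11.lean rev 2 sha16 ac452fa235bdea86 (hypType_subset_eucShape,
doorJ_exact_two, campanaHyperbolicBound_of_euclideanABC, euclideanABC_iff_hyp_and_gen, nodeR2_iff,
partition) and writer J5/RootDecompJ_R2_certificate.lean (euclideanTypeABC_iff_gen : item text ≡
critic EuclideanABCGen by Iff.rfl, closes5, nodeR2_iff), both lean check rc 0 · 0 sorry · std
axioms; declared residual 29355, asides 29508/30632, closed Assembly 29356 (old triple) untouched;
score 0; abc NOT proved.

Novelty: Searches (2026-08-30): lit search --hybrid "Campana orbifold Mordell squareful" (8 docs, generic: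
[corpus:vojta1987 p.36], [corpus:bombieri2006 p.426]); lit vsearch (8 docs, none on point); lit
search "projective line minus three fractional points Poonen" (5 corpus hits:
[corpus:paper:arxiv-1106.4472 p.8], [corpus:paper:arxiv-2601.07817 p.20],
[corpus:paper:arxiv-1001.3296 p.15], [corpus:paper:arxiv-2104.14946 p.18]); lit search "orbifold
Mordell Campana fibres multiples surface" (5: [corpus:paper:arxiv-1908.10263],
[corpus:paper:arxiv-2410.06643], [corpus:paper:arxiv-1905.02795], [corpus:paper:arxiv-2410.16766]);
lit galaxy search "Campana points|squareful numbers" --star all (17 rows; relevant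
[galaxy:pdf:-3398334937149147600] Kebekus–Rousseau C-pairs survey, [galaxy:pdf:5761717419812226080]
Blomer–Schöbel twins of powerful numbers, [galaxy:panama:257337260507234] CRM Arithmetic geometry of
logarithmic pairs, [galaxy:pdf:2190573520] ANT 2025); lit galaxy search "powerful numbers abc"
--star pdf (7 rows, noise); pages read: arxiv-2410.06643 p.2–5, arxiv-2603.28745 p.1–6,
arxiv-1106.4472 p.1–3,8, arxiv-2601.07817 p.1–2,20; tree: Theses/RootDecompA–H, negatives index (gen
5 read), Mathlib FLT/MasonStothers, AbcWave0 (darmon_granville, mihailescu, mihailescu_holds).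
Nearest prior art found: Campana 2005 / Smeets (abc ⟹ Orbifold Mordell; function-field Orbifold
Mordell) as reported in [corpus:paper:arxiv-2603.28745 p.5] and [corpus:paper:arxiv-2410.06643 p.5];
Browning–Van Valck  [refs: paper:arxiv-1106.4472, paper:arxiv-2601.07817, paper:arxiv-1001.3296, paper:arxiv-2104.14946, paper:arxiv-1908.10263, paper:arxiv-2410.06643, paper:arxiv-1905.02795, paper:arxiv-2410.16766, arxiv-2410.06643, arxiv-2603.28745, arxiv-1106.4472, arxiv-2601.07817, paper:arxiv-2603.28745]

Barriers (technique_class: campana-orbifold, darmon-granville, mason-stothers): - technique_class: campana-orbifold, darmon-granville, mason-stothers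
- Literature.Barriers.ABC.BakerMethodBounds: CampanaHyperbolicBound is a finiteness statement on a
thin set and is attacked per twist box by Faltings/Darmon–Granville, the modular method and Chabauty
(no logarithmic forms; Poonen–Schaefer–Stoll decide x²+y³=z⁷ this way) plus a uniformity-over-twists
input — OUTSIDE the class; it sits inside only through the crude implication PolyABC(43/42) ⟹ P_H,
which is a certificate, not the plan. EuclideanABC: ε-uniform abc along a CM twist family is INSIDE
for linear forms (log savings only); the bet is the arithmetic of CM twists / elliptic divisibility
sequences (IDEA-NEEDED, disclosed). SphericalABC: INSIDE, declared residual.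
- Literature.Barriers.ABC.IntegersHaveNoDerivation: evaded — Mason–Stothers is used ONLY over k[X]
(Mathlib `Polynomial.abc`), to certify in kernel that no polynomial identity map sends general
triples INTO the thin hyperbolic / Euclidean cells (transport immunity: a coprime p,q,r-full
polynomial syzygy has 1/p+1/q+1/r > 1, `no_powerful_syzygy`, `one_lt_wt_of_unit_syzygy`); nothing of
the derivative/Wronskian proof is transferred to ℤ and no derivation on ℤ is posited — the integer
pieces P_H / P_E are attacked by Faltings–Darmon–Granville, the modular method and Chabauty per
twist box, and P_S is the declared residual.
- Literature.Barriers.ABC.EpsilonCannotBeDropped: respected — P_E and P_S keep 1+ε with ineffective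
constants; P_H has no ε a

History (route lifecycle, newest last):
- 2026-08-30T21:38:13Z · RESIDUAL declared: SphericalABC (stmt-ABC-29355) — summit-strength until shown otherwise: gate10 D-0170 bookkeeping: tribunal residual of record payload.tribunal.residual [stmt-ABC-29355]; statement untouched; (planner-decomp-abc-writer-1-g23-0)
- 2026-09-01T17:07:00Z · rev 7: informal re-worded for EuclideanABC (planner-decomp-abc-writer-1-g37-0)

sub-problem: ABC · status: open · opened planner-decomp-abc-writer-1-g3-0 2026-08-30T06:29:31Z · rev 7 · ledger route-ABC-RootDecompJ
GENERATED by the gate from the ledger (D-0016/17). Provers cite these decls: `theorem foo : Summit.ABC.ABC.Theses.RootDecompJ.<Decl> := …` in Summits/ABC/ABC/Theorems/<Name>.lean.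
-/

namespace Summit.ABC.ABC.Theses.RootDecompJ

open scoped BigOperators Topology Manifold Classical MeasureTheory ProbabilityTheory Matrix InnerProductSpace ComplexConjugate ContinuousMap
open Filter Set Function TopologicalSpace MeasureTheory

attribute [summit_statement] _root_.ABC

open Literature.Abc

/-- item stmt-ABC-29353 · crux · leaf IDEA-NEEDED · rank 2 · open · by planner
why it might fail: an infinite family of coprime p-,q-,r-full solutions of ONE hyperbolic signature with unbounded powerful cofactors (e.g. x²u³ + y³v⁴w⁵ = 7-full) — none known below 10^18; it would refute abc, which implies P_H (kernel).
sources: arXiv:2410.06643, arXiv:2603.28745, arXiv:1106.4472, arXiv:1908.10263, DarmonGranville1995, arXiv:math/0508174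
[crux] ORBIFOLD MORDELL FOR THE THREE-POINT LINE OVER ℤ — there is one bound B such that every abc
triple (a,b,c) admitting multiplicities (p,q,r) (a p-full, b q-full, c r-full; ∞ ↔ member 1) with
1/p+1/q+1/r < 1 has c ≤ B. WEAKER than abc, kernel-certified: PolyABC(43/42) ⟹ P_H (abc at the
single instance ε = 1/42; integer heart rad(abc)^42 < c^41); contains Fermat–Catalan boundedness and
route E's KleinLevelOne (kernel); decided sub-boxes: Catalan corner c = 9 (tree-proved Mihăilescu),
FLT(4) box empty, fixed-signature perfect-power boxes bounded mod darmon_granville; exhaustive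
census: exactly 10 hyperbolic coprime triples with c ≤ 10^10 (four not perfect-power triples, e.g.
5³ + 3⁷ = 2³·17²) plus the five known Fermat–Catalan solutions above 10^10; the (2,3,7) positional
corner exhausted to 10^18 with 3 members (census-1 kit j338739). [difficulty: open-problem] -/
@[route_item "route-ABC-RootDecompJ", crux (bottleneck := idea) (source := "ledger D-0171 leaf tag IDEA-NEEDED on stmt-ABC-29353, 2026-09-01")]
def CampanaHyperbolicBound : Prop :=
  ∃ B : ℕ, ∀ a b c : ℕ, Literature.NumberTheory.DiophantineGeometry.IsABCTriple a b c → (∃ p q r : ℕ, ((p = 0 → a = 1) ∧ ∀ ℓ ∈ a.primeFactors, p ≤ a.factorization ℓ) ∧ ((q = 0 → b = 1) ∧ ∀ ℓ ∈ b.primeFactors, q ≤ b.factorization ℓ) ∧ ((r = 0 → c = 1) ∧ ∀ ℓ ∈ c.primeFactors, r ≤ c.factorization ℓ) ∧ (p : ℚ)⁻¹ + (q : ℚ)⁻¹ + (r : ℚ)⁻¹ < 1) → c ≤ B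

/-- item stmt-ABC-27064 · crux · leaf IDEA-NEEDED · rank 3 · open · by planner
why it might fail: cannot fail without refuting abc (restriction, NEC in kernel); as a TARGET: abc along ONE CM twist x³+y³=A of positive rank is open — EDS primitive-divisor / Siegel bounds are ineffective or save only logarithms, and uniformity in the twist A and over Pell powerful parts needs an idea.
sources: arXiv:1106.4472, arXiv:2404.03970, arXiv:2601.07817, Nitaj1995, arXiv:math/0508174
[crux — R2, replaces EuclideanABC 29354 as the Euclidean binder of closes] abc (∀ ε ∃ C, c <
C·rad^{1+ε}) on the abc triples of genuinely EUCLIDEAN CAMPANA TYPE: some admissible powerfulness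
signature (p,q,r) (a p-full, b q-full, c r-full; ∞ only at the member 1, encoded 0 with weight 0)
has weight 1/p+1/q+1/r EXACTLY 1 and NO admissible signature has weight < 1 — the χ = 0 thin cell of
the orbifold (ℙ¹; Δ_{p,q,r}): integral points of the CM-twist families x³+y³=Az³ / (3,3,3),
y²=x³+Az⁶-type (2,3,6), x⁴+Ay⁴=z² (2,4,4) and the consecutive-powerful / Pell family (∞,2,2) (1,
8y², x²). Census of record: 14 of the 20185 known abc hits; exactly 26 members with c ≤ 10^10 and 74
with c ≤ 10^18 (kit j338961, census g7) — the figures the rev-3 informal of 29354 quoted for a cell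
that, AS TYPED (EucShape = «admits a weight-1 signature»), contains the whole hyperbolic cell
(HypType ⊆ EucShape by downward closure of admissibility: critic g11 kernel
`hypType_subset_eucShape`; 23 hits / 36 ≤ 10^10 / 93 ≤ 10^18). WHY HONEST: NECESSARY (restriction of
abc; kernel `euclideanTypeABC_of_abc`), STRICTLY INSIDE the old binder (EuclideanABC ↔
CampanaHyperbolicBound ∧ EuclideanTypeABC, kernel, critic HOME -/
@[route_item "route-ABC-RootDecompJ", crux (bottleneck := idea) (source := "ledger D-0171 leaf tag IDEA-NEEDED on stmt-ABC-27064, 2026-09-01")]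
def EuclideanTypeABC : Prop :=
  ∀ ε : ℝ, 0 < ε → ∃ C : ℝ, 0 < C ∧ ∀ a b c : ℕ, Literature.NumberTheory.DiophantineGeometry.IsABCTriple a b c → ((∃ p q r : ℕ, ((p = 0 → a = 1) ∧ ∀ ℓ ∈ a.primeFactors, p ≤ a.factorization ℓ) ∧ ((q = 0 → b = 1) ∧ ∀ ℓ ∈ b.primeFactors, q ≤ b.factorization ℓ) ∧ ((r = 0 → c = 1) ∧ ∀ ℓ ∈ c.primeFactors, r ≤ c.factorization ℓ) ∧ (p : ℚ)⁻¹ + (q : ℚ)⁻¹ + (r : ℚ)⁻¹ = 1) ∧ ¬ (∃ p q r : ℕ, ((p = 0 → a = 1) ∧ ∀ ℓ ∈ a.primeFactors, p ≤ a.factorization ℓ) ∧ ((q = 0 → b = 1) ∧ ∀ ℓ ∈ b.primeFactors, q ≤ b.factorization ℓ) ∧ ((r = 0 → c = 1) ∧ ∀ ℓ ∈ c.primeFactors, r ≤ c.factorization ℓ) ∧ (p : ℚ)⁻¹ + (q : ℚ)⁻¹ + (r : ℚ)⁻¹ < 1)) → (c : ℝ) < C * ((Literature.NumberTheory.DiophantineGeometry.rad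 a b c : ℕ) : ℝ) ^ (1 + ε)

/-- item stmt-ABC-29355 · crux · RESIDUAL (gen 0; summit-strength until shown otherwise, D-0170) · leaf IDEA-NEEDED · rank 4 · open · by planner
why it might fail: it is abc on a co-thin set (abc-in-waiting by population, declared); inside Literature.Barriers.ABC.BakerMethodBounds for any ε-uniform statement — disclosed, same species as the residuals of B/G/E.
sources: arXiv:1106.4472, StewartYu2001, Mathlib:Polynomial.abc
[crux] abc (for every ε, some C) on the SPHERICAL triples: every admissible (p,q,r) has 1/p+1/q+1/r
> 1 — in particular every triple with a prime to the first power in two of its members. DECLARED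
RESIDUAL (≈ abc: 20162 of the 20185 known hits); it receives every identity-based transport by the
kernel theorem no_powerful_syzygy (Mason–Stothers: coprime polynomial identities with p-,q-,r-full
members are spherical), and it is NOT kernel-costume: the probes P_S → ABC fail under three
batteries, the squared Pythagorean transport escaping to the other cells exactly on the
doubly-squareful thin set. [difficulty: open-problem] -/
@[route_item "route-ABC-RootDecompJ", crux (bottleneck := idea) (source := "ledger wanted_by.residual on stmt-ABC-29355, 2026-09-01")]
def SphericalABC : Prop :=
  ∀ ε : ℝ, 0 < ε → ∃ C : ℝ, 0 < C ∧ ∀ a b c : ℕ, Literature.NumberTheory.DiophantineGeometry.IsABCTriple a b c → (∀ p q r : ℕ, ((p = 0 → a = 1) ∧ ∀ ℓ ∈ a.primeFactors, p ≤ a.factorization ℓ) → ((q = 0 → b = 1) ∧ ∀ ℓ ∈ b.primeFactors, q ≤ b.factorization ℓ) → ((r = 0 → c = 1) ∧ ∀ ℓ ∈ c.primeFactors, r ≤ c.factorization ℓ) → 1 < (p : ℚ)⁻¹ + (q : ℚ)⁻¹ + (r : ℚ)⁻¹) → (c : ℝ) < C * ((Literature.NumberTheory.DiophantineGeometry.rad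 a b c : ℕ) : ℝ) ^ (1 + ε)

/-- item stmt-ABC-29354 · aside · leaf IDEA-NEEDED · rank 3 · open · by planner
why it might fail: it cannot fail without refuting abc (restriction); as a target, abc along ONE CM twist of positive rank is already open — elliptic divisibility / Siegel give ineffective or logarithmic savings only, so ε-uniformity over the cell needs an idea.
sources: arXiv:1106.4472, arXiv:2404.03970, arXiv:2601.07817, Nitaj1995
[aside since R2 2026-09-01 (writer decomp-abc-writer-1 g37, critic crit-1 g11 kernel certificate
HOME/critic/DoorJ_HypInEuc_g11.lean rev 2 sha16 ac452fa235bdea86) — banked rev-3 binder, KEPT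
VERBATIM because landed Theorems (PlatonicClosureTransport / Octahedral / Closes / PlatonicClosure,
RootDecompJAssembly) cite it by Iff.rfl; SUFFICIENT for abc together with SphericalABC alone (critic
`closes_without_hyperbolic`), never staffed; in kernel EuclideanABC ⟺ CampanaHyperbolicBound ∧
EuclideanTypeABC (critic `euclideanABC_iff_hyp_and_gen` = writer `euclideanABC_iff_hyp_and_type`):
AS TYPED its cell is «admits a weight-1 admissible signature», which CONTAINS the whole hyperbolic
cell since admissibility is downward closed in the multiplicities (HypType ⊆ EucShape, critic
`hypType_subset_eucShape`; e.g. 1+8=9 admits (6,3,2), 2⁵+7²=3⁴ admits (4,2,4)) — i.e. abc on the χ ≤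
0 cell, 23 of the 20185 known hits, 36 members with c ≤ 10^10, 93 with c ≤ 10^18; the figures «26 ≤
10^10 / 14 hits» below are those of the genuinely Euclidean χ = 0 sub-cell EucShape ∖ HypType, now
the separate binder EuclideanTypeABC.] [crux] abc (for every ε, some C) on the EUCLIDEAN-SHAPED
triples: some admissible -/
@[route_item "route-ABC-RootDecompJ", crux (bottleneck := idea) (source := "ledger D-0171 leaf tag IDEA-NEEDED on stmt-ABC-29354, 2026-09-01")]
def EuclideanABC : Prop :=
  ∀ ε : ℝ, 0 < ε → ∃ C : ℝ, 0 < C ∧ ∀ a b c : ℕ, Literature.NumberTheory.DiophantineGeometry.IsABCTriple a b c → (∃ p q r : ℕ, ((p = 0 → a = 1) ∧ ∀ ℓ ∈ a.primeFactors, p ≤ a.factorization ℓ) ∧ ((q = 0 → b = 1) ∧ ∀ ℓ ∈ b.primeFactors, q ≤ b.factorization ℓ) ∧ ((r = 0 → c = 1) ∧ ∀ ℓ ∈ c.primeFactors, r ≤ c.factorization ℓ) ∧ (p : ℚ)⁻¹ + (q : ℚ)⁻¹ + (r : ℚ)⁻¹ = 1) → (c : ℝ) < C * ((Literature.NumberTheory.DiophantineGeometry.rad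 a b c : ℕ) : ℝ) ^ (1 + ε)

/-- item stmt-ABC-29508 · aside · rank 9 · closed · proved by Summit.ABC.ABC.Theorems.rootDecompJ_campanaSupportRung_proof (prover) · by planner
[aside] RUNG-RECORD of CampanaHyperbolicBound by support (critic g2 w1; B/G KummerSupportRung
style): for every finite set of primes S the HYPERBOLIC abc triples supported on S have bounded c —
KNOWN for every S (S-unit equation x + y = z: Mahler 1933; effective Győry 1979 / Baker; complete
lists in print for S = primes ≤ 13, de Weger 1987, and S = first 16 primes, von Känel–Matschke),
kernel for S ⊆ {2,3} via the Catalan corner (B = 9); P_H = B uniform in S (kernel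
campanaSupportRung_of_hypBound in HOME/decomp-abc-lens-1/g6/CampanaTrichotomy.lean). Closable modulo
a Literature fact (S-unit finiteness over ℚ, to be typed). Sources: deWeger1987, Gyory1979,
vonKanelMatschke2016, Mahler1933. -/
@[route_item "route-ABC-RootDecompJ"]
def CampanaSupportRung : Prop :=
  ∀ S : Finset ℕ, ∃ B : ℕ, ∀ a b c : ℕ, Literature.NumberTheory.DiophantineGeometry.IsABCTriple a b c → (a * b * c).primeFactors ⊆ S → (∃ p q r : ℕ, ((p = 0 → a = 1) ∧ ∀ ℓ ∈ a.primeFactors, p ≤ a.factorization ℓ) ∧ ((q = 0 → b = 1) ∧ ∀ ℓ ∈ b.primeFactors, q ≤ b.factorization ℓ) ∧ ((r = 0 → c = 1) ∧ ∀ ℓ ∈ c.primeFactors, r ≤ c.factorization ℓ) ∧ (p : ℚ)⁻¹ + (q : ℚ)⁻¹ + (r : ℚ)⁻¹ < 1) → c ≤ B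

-- `CampanaSupportRung` holds: proved by `Summit.ABC.ABC.Theorems.rootDecompJ_campanaSupportRung_proof` (its module imports this route file, so no `_holds` link can be stated here).

/-- item stmt-ABC-30632 · aside · rank 9 · open · by planner
why it might fail: If a Belyi map /ℚ of degree > 60 with ramification floors (2,3,5) and ≥ 3 rational special points exists (test T_ico: d = 66, 70, 72, …), IcosahedralABC ≡ ABC by abc_of_transport (costume); else it still contains abc for the 27 Edwards–Klein degree-60 forms (open).
sources: doi:10.1215/s0012-7094-98-09105-0, doi:10.1515/crll.2004.043, galaxy:panama:275427662757932 (Klein, Icosahedron I §13 p.82), corpus:bombieri2006 p.412 Thm 12.4.1/Rem 12.4.2, corpus:bombieri2006 p.424 Thm 12.5.12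
[aside] abc, ε-uniform, on the ICOSAHEDRAL CELL: spherical abc triples (every admissible (p,q,r) has
1/p+1/q+1/r > 1) admitting multiplicities all ≥ 2, two of them ≥ 3, one of them ≥ 5 — i.e.
powerfulness profile exactly (2,3,5) up to order (a squareful, a cube-full and a 5-full member; 10²
+ 3⁵ = 7³; contains all coprime solutions of x²+y³=z⁵, Beukers 1998 / Edwards 2004; population ≍
B^{1/30}). The unique symmetric spherical level NOT loaded by a quality-preserving transport of
Riemann–Hurwitz-minimal degree (Klein's icosahedral map has no ℚ-model with three rational special
points). TAGS (lens-1 g7): NEW · UNDECIDED-with-test T_ico · WEAKER-formal (ABC ⟹ it, kernel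
node_iff7) · bc2 probe P_I→ABC FAILS · bc7 CLEAN · populated (kernel icoCell_100_243_343) ·
INSTRUMENTABLE (passport search d = 66, 70, 72, …; census K-PLATONIC18). CRITIC (decomp-abc-crit-1
g2, STATUS l.470 07:48:07Z): CLEARED as RESPLIT-cum-BLOCKER node on door J; IcosahedralABC
«UNDECIDED:T_ico · populated · INSTRUMENTABLE (K-PLATONIC18 l.466)»; OctahedralABC «DECLARED
RESIDUAL · costume-by-transport (kernel) · no attack» (not filed at W7-0); REGISTRY += R-PROFILE.
WRITER g4 TAGS: W7-0 = filed as ASIDE r9 (banked c -/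
@[route_item "route-ABC-RootDecompJ", crux]
def IcosahedralABC : Prop :=
  ∀ ε : ℝ, 0 < ε → ∃ C : ℝ, 0 < C ∧ ∀ a b c : ℕ, Literature.NumberTheory.DiophantineGeometry.IsABCTriple a b c → ((∀ p q r : ℕ, ((p = 0 → a = 1) ∧ ∀ ℓ ∈ a.primeFactors, p ≤ a.factorization ℓ) → ((q = 0 → b = 1) ∧ ∀ ℓ ∈ b.primeFactors, q ≤ b.factorization ℓ) → ((r = 0 → c = 1) ∧ ∀ ℓ ∈ c.primeFactors, r ≤ c.factorization ℓ) → 1 < (p : ℚ)⁻¹ + (q : ℚ)⁻¹ + (r : ℚ)⁻¹) ∧ (∃ p q r : ℕ, ((p = 0 → a = 1) ∧ ∀ ℓ ∈ a.primeFactors, p ≤ a.factorization ℓ) ∧ ((q = 0 → b = 1) ∧ ∀ ℓ ∈ b.primeFactors, q ≤ b.factorization ℓ) ∧ ((r = 0 → c = 1) ∧ ∀ ℓ ∈ c.primeFactors, r ≤ c.factorization ℓ) ∧ (2 ≤ p ∧ 2 ≤ q ∧ 2 ≤ r ∧ (3 ≤ p ∧ 3 ≤ q ∨ 3 ≤ q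 ∧ 3 ≤ r ∨ 3 ≤ r ∧ 3 ≤ p) ∧ (5 ≤ p ∨ 5 ≤ q ∨ 5 ≤ r)))) → (c : ℝ) < C * ((Literature.NumberTheory.DiophantineGeometry.rad a b c : ℕ) : ℝ) ^ (1 + ε)

/-- item stmt-ABC-29356 · assembly · rank 1 · closed · proved by Summit.ABC.ABC.Theorems.rootDecompJ_assembly_proof (prover) · by planner
sources: arXiv:1106.4472
[assembly] CampanaHyperbolicBound → EuclideanABC → SphericalABC → ABC (trichotomy of the minimal
weight over admissible multiplicities; bounded c absorbed by rad^(1+ε) ≥ 1). -/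
@[route_item "route-ABC-RootDecompJ"]
def Assembly : Prop :=
  CampanaHyperbolicBound → EuclideanABC → SphericalABC → _root_.ABC

-- `Assembly` holds: proved by `Summit.ABC.ABC.Theorems.rootDecompJ_assembly_proof` (its module imports this route file, so no `_holds` link can be stated here).

/-! D-0027 §2.1 — DECIDING THEOREM (planner-authored via `route open/edit --closes-file`; by planner-decomp-abc-writer-1-g37-0 2026-09-01T17:05:47Z):
its hypotheses are this route's items and its conclusion the sub-problem Statement (glue_lint), and it elaborates with this file. -/

/-- R2 deciding theorem for route RootDecompJ (CampanaTrichotomy), writer decomp-abc-writer-1 g37 under planner tenure, 2026-09-01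
(critic decomp-abc-crit-1 g11 SUMMON 20260901T163949Z + ADDENDUM, kernel certificate HOME/critic/DoorJ_HypInEuc_g11.lean rev 2
sha16 ac452fa235bdea86; writer certificate J5/RootDecompJ_R2_certificate.lean `closes5` / `nodeR2_iff`, rc0, std axioms):
abc follows from Campana's Orbifold Mordell bound on the HYPERBOLIC cell (`CampanaHyperbolicBound`, stmt-ABC-29353: some admissible
(p,q,r) has weight 1/p+1/q+1/r < 1), abc on the triples of genuinely EUCLIDEAN Campana type (`EuclideanTypeABC`: some admissible
signature has weight exactly 1 AND none has weight < 1 — the χ = 0 thin cell: CM twists (2,3,6),(2,4,4),(3,3,3) + consecutive powerful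
numbers (∞,2,2)), and abc on the SPHERICAL bulk (`SphericalABC`, stmt-ABC-29355, DECLARED RESIDUAL: every admissible weight > 1), by the
trichotomy of the weight. EXACT node: ABC ⟺ P_H ∧ P_E′ ∧ P_S (`nodeR2_iff`), the three cells a genuine PARTITION (cover + pairwise
disjoint, critic `hyp_or_genEuc_or_sph`). Supersedes the rev-3 binder `EuclideanABC` (stmt-ABC-29354, kept ASIDE verbatim: as typed its
cell EucShape ⊇ HypType, and `EuclideanABC ↔ CampanaHyperbolicBound ∧ EuclideanTypeABC` in kernel — critic `euclideanABC_iff_hyp_and_gen`,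
writer `euclideanABC_iff_hyp_and_type`). abc is NOT proved: the residual is a hypothesis. -/
@[closes "route-ABC-RootDecompJ"] theorem closes (h₁ : CampanaHyperbolicBound) (h₂ : EuclideanTypeABC) (h₃ : SphericalABC) : _root_.ABC := by
  rw [_root_.ABC_iff]
  intro ε hε
  obtain ⟨B, hB⟩ := h₁
  obtain ⟨C₁, hC₁, hE⟩ := h₂ ε hε
  obtain ⟨C₂, hC₂, hS⟩ := h₃ ε hε
  refine ⟨max ((B : ℝ) + 1) (max C₁ C₂), lt_max_of_lt_left (by positivity), fun a b c ht => ?_⟩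
  have hrad : 0 < Literature.NumberTheory.DiophantineGeometry.rad a b c := by
    rw [Literature.NumberTheory.DiophantineGeometry.rad_def]; exact Nat.radical_pos _
  have hR1 : (1 : ℝ) ≤ ((Literature.NumberTheory.DiophantineGeometry.rad a b c : ℕ) : ℝ) ^ (1 + ε) :=
    Real.one_le_rpow (by exact_mod_cast hrad) (by linarith)
  have hR0 : (0 : ℝ) < ((Literature.NumberTheory.DiophantineGeometry.rad a b c : ℕ) : ℝ) ^ (1 + ε) := by
    linarith
  by_cases hH : ∃ p q r : ℕ, ((p = 0 → a = 1) ∧ ∀ ℓ ∈ a.primeFactors, p ≤ a.factorization ℓ) ∧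
      ((q = 0 → b = 1) ∧ ∀ ℓ ∈ b.primeFactors, q ≤ b.factorization ℓ) ∧
      ((r = 0 → c = 1) ∧ ∀ ℓ ∈ c.primeFactors, r ≤ c.factorization ℓ) ∧
      (p : ℚ)⁻¹ + (q : ℚ)⁻¹ + (r : ℚ)⁻¹ < 1
  · have hc : (c : ℝ) ≤ B := by exact_mod_cast hB a b c ht hH
    calc (c : ℝ) < (B : ℝ) + 1 := by linarith
      _ ≤ ((B : ℝ) + 1) * ((Literature.NumberTheory.DiophantineGeometry.rad a b c : ℕ) : ℝ) ^ (1 + ε) :=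
          le_mul_of_one_le_right (by positivity) hR1
      _ ≤ _ := mul_le_mul_of_nonneg_right (le_max_left _ _) hR0.le
  by_cases hEu : ∃ p q r : ℕ, ((p = 0 → a = 1) ∧ ∀ ℓ ∈ a.primeFactors, p ≤ a.factorization ℓ) ∧
      ((q = 0 → b = 1) ∧ ∀ ℓ ∈ b.primeFactors, q ≤ b.factorization ℓ) ∧
      ((r = 0 → c = 1) ∧ ∀ ℓ ∈ c.primeFactors, r ≤ c.factorization ℓ) ∧
      (p : ℚ)⁻¹ + (q : ℚ)⁻¹ + (r : ℚ)⁻¹ = 1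
  · exact (hE a b c ht ⟨hEu, hH⟩).trans_le
      (mul_le_mul_of_nonneg_right ((le_max_left _ _).trans (le_max_right _ _)) hR0.le)
  have hSp : ∀ p q r : ℕ, ((p = 0 → a = 1) ∧ ∀ ℓ ∈ a.primeFactors, p ≤ a.factorization ℓ) →
      ((q = 0 → b = 1) ∧ ∀ ℓ ∈ b.primeFactors, q ≤ b.factorization ℓ) →
      ((r = 0 → c = 1) ∧ ∀ ℓ ∈ c.primeFactors, r ≤ c.factorization ℓ) →
      1 < (p : ℚ)⁻¹ + (q : ℚ)⁻¹ + (r : ℚ)⁻¹ := by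
    intro p q r hp hq hr
    rcases lt_trichotomy ((p : ℚ)⁻¹ + (q : ℚ)⁻¹ + (r : ℚ)⁻¹) 1 with h | h | h
    · exact absurd ⟨p, q, r, hp, hq, hr, h⟩ hH
    · exact absurd ⟨p, q, r, hp, hq, hr, h⟩ hEu
    · exact h
  exact (hS a b c ht hSp).trans_le
    (mul_le_mul_of_nonneg_right ((le_max_right _ _).trans (le_max_right _ _)) hR0.le)

end Summit.ABC.ABC.Theses.RootDecompJ
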